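import Literature.NumberTheory.Multiplicative.SigmaTotientExtremalOrders
import Literature.NumberTheory.LFunctions.RHClassicalEquivalentsRobinProofs
import Literature.NumberTheory.LFunctions.RobinNumerical
import Literature.NumberTheory.LFunctions.ColossallyAbundant
import Mathlib.Data.Nat.Factorization.Basic
import HarnessLib

/-!
# RH-EQUIVALENT — extraordinary (GA1/GA2) numbers and extremely abundant numbers: the criteria of Caveney–Nicolas–Sondow (2011, 2012) and Nazardonyavi–Yakubovich (2014)

RH-EQUIVALENT (statements `RiemannHypothesis ↔ …` about record values of Gronwall's function
`G(n) = σ(n)/(n log log n)`), plus the RH-FREE inputs they rest on; nothing here bears on the truth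
of RH. Literature-typing tranche 1 (Broughan, *Equivalents of the Riemann Hypothesis* vol. 1,
Ch. 8 "Numbers that do not satisfy Robin's inequality", pp. 200–217, and Ch. 9 "Left, right and
extremely abundant numbers", pp. 218–235; MacKay's review, LMS Newsletter 480: "Perhaps the most
delightful is the Caveney–Nicolas–Sondow equivalent: the only extraordinary number is 4").

Contents (`G = gronwallG`; `σ = ArithmeticFunction.sigma 1`, `γ = Real.eulerMascheroniConstant`):

* DEFINITIONS (with bodies): `gronwallG`; `IsGA1 N` ("`N` composite and `G(N/p) ≤ G(N)` for every
  prime `p ∣ N`"), `IsGA2 N` ("`N > 1` and `G(aN) ≤ G(N)` for every multiple `aN`"),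
  `IsExtraordinary N` (composite, GA1 and GA2 — CNS 2011 Def. 1 = CNS 2012 §1),
  `IsExtremelyAbundant n` (Nazardonyavi–Yakubovich 2014, Def. 2.1: `n = 10080`, or `n > 10080` and
  `G(m) < G(n)` for all `10080 ≤ m < n`).
* PROVED: `robinInequality n ↔ G(n) < e^γ` (`n ≥ 3`); CNS 2011 Lemma 1 / CNS 2012 (1.11) in the form
  `IsGA2 N → e^γ ≤ G(N)` (`IsGA2.exp_eulerMascheroni_le_gronwallG`, from Gronwall's theorem along the
  multiples of `N`, re-using the Hardy–Wright sequence `(x#)^⌊log x⌋` of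
  `Multiplicative/SigmaTotientExtremalOrders.lean`); CNS 2012 Thm. 5 (ii) (under RH no GA2 number
  exceeds `5040`, `CNS2012_thm5_ii_of`); Nazardonyavi–Yakubovich Thm. 2.3 (the least counterexample
  to Robin's inequality is extremely abundant) and **Thm. 2.4: `RH ⟺` there are infinitely many
  extremely abundant numbers** (`riemannHypothesis_iff_setOf_isExtremelyAbundant_infinite`, from
  Robin's criterion `robin_iff_holds`, Gronwall's theorem `lim sup G = e^γ` and the tree's kernel
  check of Robin's inequality on `(5040, 55440]`); kernel-grade `_of` variants take `robin_iff` as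
  a hypothesis, the unconditional ones inherit the `computational` closure of `robin_iff_holds`.
* NAMED FACTS (not proved here): Robin 1984 Thm. 2 (the unconditional bound
  `σ(n)/n ≤ e^γ log log n + 0.6482…/log log n`, `n ≥ 3`, RH-FREE); CNS 2011 Thm. 5 (`RH ⟺ 4` is the
  only extraordinary number) and Cor. 1; CNS 2012 Thm. 5 (i) (the nineteen GA2 numbers `≤ 5040`),
  (iii) (if RH fails there are infinitely many GA2 numbers and the maximisers of `G` on `n > 5040`
  are GA2 and colossally abundant) and Cor. 1 (no GA2 or extraordinary number in `(5040, 10^8576]`).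
  From (ii)+(iii): `RH ⟺` every GA2 number is `≤ 5040` `⟺` the GA2 numbers form a finite set
  (`riemannHypothesis_iff_forall_isGA2_le_of`, PROVED from the facts).

AS-PRINTED FLAGS. `G(1)` and `G(2)`: `log log 1 = log 0 = 0` in Lean (so `G(1) = 0` by `x/0 = 0`),
and `G(2) = 3/(2 log log 2) < 0` genuinely (CNS 2011 use `G(2) < 0` to see that `4` is GA1); no
statement below evaluates `G` at `1` (GA1 requires `N` composite, so `N/p ≥ 2`; GA2 requires
`N > 1`; XA numbers are `≥ 10080`). "Composite" is `1 < N ∧ ¬ N.Prime`.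

## References

* G. Caveney, J.-L. Nicolas, J. Sondow, *Robin's theorem, primes, and a new elementary
  reformulation of the Riemann Hypothesis*, Integers 11 (2011) A33, 753–763 (arXiv:1110.5078):
  Def. 1, Thm. 5, Cor. 1, Lemma 1, display (2) (Robin's unconditional bound). [CaveneyNicolasSondow2011] (held)
* G. Caveney, J.-L. Nicolas, J. Sondow, *On SA, CA, and GA numbers*, Ramanujan J. 29 (2012)
  359–384 (arXiv:1112.6010): §1 (GA1, GA2, extraordinary; Thm. 4), (1.11) `N GA2 ⟹ G(N) ≥ e^γ`,
  Thm. 5 (i)–(iii), Cor. 1. [CaveneyNicolasSondow2012] (held)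
* S. Nazardonyavi, S. Yakubovich, *Extremely abundant numbers and the Riemann hypothesis*,
  J. Integer Seq. 17 (2014), Article 14.2.8 (arXiv:1211.2147, §2): Def. 2.1, Prop. 2.2, Thm. 2.3,
  Thm. 2.4. [NazardonyaviYakubovich2014] (held)
* G. Robin, *Grandes valeurs de la fonction somme des diviseurs et hypothèse de Riemann*, J. Math.
  Pures Appl. 63 (1984) 187–213, Thm. 1, Thm. 2. [Robin1984]
* K. Broughan, *Equivalents of the Riemann Hypothesis. Vol. 1*, CUP 2017, Ch. 8 (pp. 200–217),
  Ch. 9 (pp. 218–235). [Broughan2017Arithmetic] (not held, acq-00318)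
* G. H. Hardy, E. M. Wright, Thm. 323 (Gronwall), §22.9. [HardyWright2008]
-/

noncomputable section

open Real Filter Finset
open scoped ArithmeticFunction.sigma

namespace Literature.NumberTheory.LFunctions

open Literature.NumberTheory.Multiplicative.ExtremalOrder

/-! ### Gronwall's function `G(n) = σ(n)/(n log log n)` -/

/-- Gronwall's function `G(n) = σ(n)/(n log log n)` (`n > 1`; CNS 2011, Thm. 1; Nazardonyavi–
Yakubovich write `f(n)`). Same expression as in the tree's Gronwall theorem
`Multiplicative.ExtremalOrder.limsup_sigma_div_loglog`. Junk values at `n ≤ 1` (see module docstring).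
[cite: CaveneyNicolasSondow2011, Thm. 1 (definition of G)] -/
def gronwallG (n : ℕ) : ℝ :=
  (σ 1 n : ℝ) / (n * Real.log (Real.log n))

/-- Unfolding lemma. [cite: CaveneyNicolasSondow2011, Thm. 1 (definition of G)] -/
theorem gronwallG_def (n : ℕ) : gronwallG n = (σ 1 n : ℝ) / (n * Real.log (Real.log n)) := rfl

/-- `log log n > 0` for `n ≥ 3`. [folklore] -/
private theorem loglog_natCast_pos {n : ℕ} (hn : 3 ≤ n) : 0 < Real.log (Real.log n) :=
  Real.log_pos (one_lt_log_natCast hn)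

/-- Robin's inequality at `n ≥ 3` says exactly `G(n) < e^γ` (CNS 2011, Thm. 3 in `G`-form).
[cite: CaveneyNicolasSondow2011, Thm. 3] -/
theorem robinInequality_iff_gronwallG_lt {n : ℕ} (hn : 3 ≤ n) :
    robinInequality n ↔ gronwallG n < rexp eulerMascheroniConstant := by
  have hpos : 0 < (n : ℝ) * Real.log (Real.log n) :=
    mul_pos (by exact_mod_cast (show 0 < n by omega)) (loglog_natCast_pos hn)
  rw [robinInequality, gronwallG, div_lt_iff₀ hpos, mul_assoc]

/-- A failure of Robin's inequality at `n ≥ 3` is `G(n) ≥ e^γ`. [cite: CaveneyNicolasSondow2011, Thm. 3] -/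
theorem exp_eulerMascheroni_le_gronwallG_of_not_robinInequality {n : ℕ} (hn : 3 ≤ n)
    (h : ¬ robinInequality n) : rexp eulerMascheroniConstant ≤ gronwallG n :=
  not_lt.1 fun h' => h ((robinInequality_iff_gronwallG_lt hn).2 h')

/-! ### RH-FREE input: Robin's unconditional bound (Robin 1984, Thm. 2) -/

/-- NAMED FACT, RH-FREE (Robin 1984, Thm. 2; as restated by Nazardonyavi–Yakubovich 2014, (1.5):
"`f(n) ≤ e^γ + 0.6482…/(log log n)²` (`n ≥ 3`), where `0.6482… ≈ (7/3 − e^γ log log 12) log log 12`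
and the left hand side attains its maximum at `n = 12`", and by CNS 2011, (2), with the rounded
constant `0.6483`): for every `n ≥ 3`,
`σ(n)/n ≤ e^γ log log n + C/log log n` with `C = (7/3 − e^γ log log 12) · log log 12 = 0.6482…`
(equality at `n = 12`, where `σ(12)/12 = 7/3`). Users take `(h : Robin1984_thm2)`.
[cite: Robin1984, Thm. 2; NazardonyaviYakubovich2014, (1.5); CaveneyNicolasSondow2011, (2)] -/
def Robin1984_thm2 : Prop :=
  ∀ n : ℕ, 3 ≤ n →
    (σ 1 n : ℝ) / n ≤
      rexp eulerMascheroniConstant * Real.log (Real.log n) +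
        (7 / 3 - rexp eulerMascheroniConstant * Real.log (Real.log 12)) * Real.log (Real.log 12) /
          Real.log (Real.log n)

/-! ### GA1, GA2 and extraordinary numbers (Caveney–Nicolas–Sondow) -/

/-- **GA1 numbers** (CNS 2012, §1; condition (i) of CNS 2011, Def. 1): `N` is composite and
`G(N/p) ≤ G(N)` for every prime factor `p` of `N`. [cite: CaveneyNicolasSondow2012, §1 (definition of GA1)] -/
def IsGA1 (N : ℕ) : Prop :=
  1 < N ∧ ¬ N.Prime ∧ ∀ p : ℕ, p.Prime → p ∣ N → gronwallG (N / p) ≤ gronwallG N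

/-- **GA2 numbers** (CNS 2012, §1; condition (ii) of CNS 2011, Def. 1): `N > 1` and
`G(aN) ≤ G(N)` for every multiple `aN` (`a ≥ 1`). [cite: CaveneyNicolasSondow2012, §1 (definition of GA2)] -/
def IsGA2 (N : ℕ) : Prop :=
  1 < N ∧ ∀ a : ℕ, 1 ≤ a → gronwallG (a * N) ≤ gronwallG N

/-- **Extraordinary numbers** (CNS 2011, Def. 1: "`N` is extraordinary if `N` is composite and
satisfies (i) `G(N) ≥ G(N/p)` for all prime factors `p` of `N`, and (ii) `G(N) ≥ G(aN)` for all
multiples `aN` of `N`"; CNS 2012, §1: "a composite number is extraordinary if it is both GA1 and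
GA2"). [cite: CaveneyNicolasSondow2011, Def. 1] -/
def IsExtraordinary (N : ℕ) : Prop :=
  IsGA1 N ∧ IsGA2 N

/-- An extraordinary number is composite (part of GA1). [cite: CaveneyNicolasSondow2011, Def. 1] -/
theorem IsExtraordinary.one_lt_and_not_prime {N : ℕ} (h : IsExtraordinary N) :
    1 < N ∧ ¬ N.Prime :=
  ⟨h.1.1, h.1.2.1⟩

/-! ### CNS 2011 Lemma 1 / CNS 2012 (1.11): a GA2 number has `G(N) ≥ e^γ` (PROVED) -/

/-- `n ∣ (x#)^j` as soon as `x ≥ n` and `j ≥ n` (every prime power `p^a ∥ n` has `p ≤ n ≤ x` and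
`a < n ≤ j`). [folklore] -/
private theorem dvd_primorial_pow {n x j : ℕ} (hn : 1 ≤ n) (hx : n ≤ x) (hj : n ≤ j) :
    n ∣ primorial x ^ j := by
  have hn0 : n ≠ 0 := by omega
  have hP0 : primorial x ^ j ≠ 0 := pow_ne_zero _ (primorial_pos x).ne'
  rw [← Nat.factorization_le_iff_dvd hn0 hP0, Nat.factorization_pow]
  intro p
  rw [Finsupp.smul_apply, smul_eq_mul]
  by_cases hp : p ∈ n.primeFactors
  · have hpp : p.Prime := Nat.prime_of_mem_primeFactors hp
    have hpn : p ≤ n := Nat.le_of_mem_primeFactors hp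
    have h1 : (primorial x).factorization p = 1 := by
      have hsq := squarefree_primorial x
      have hmem : p ∈ (primorial x).primeFactors := by
        rw [primeFactors_primorial]
        exact Nat.mem_primesLE.2 ⟨hpn.trans hx, hpp⟩
      have hle := (Nat.squarefree_iff_factorization_le_one (primorial_pos x).ne').1 hsq p
      have hge : 0 < (primorial x).factorization p :=
        Nat.Prime.factorization_pos_of_dvd hpp (primorial_pos x).ne' (Nat.dvd_of_mem_primeFactors hmem)
      omega
    rw [h1, mul_one]
    exact le_trans (Nat.factorization_lt p hn0).le hj
  · rw [Finsupp.notMem_support_iff.1 hp]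
    exact Nat.zero_le _

/-- **Gronwall's theorem along the multiples of a fixed `n₀`** (CNS 2011, Lemma 1, the `≥` half:
"`lim sup_{a→∞} G(a n₀) = e^γ`"; Hardy–Wright's sequence `(x#)^⌊log x⌋` of §22.9 consists of
multiples of `n₀` for `x` large): for every `c < e^γ` and `n₀ ≥ 1` there is a multiple `a n₀`,
`a ≥ 1`, with `c ≤ G(a n₀)`. [cite: CaveneyNicolasSondow2011, Lemma 1] -/
theorem exists_multiple_le_gronwallG {c : ℝ} (hc : c < rexp eulerMascheroniConstant) {n₀ : ℕ}
    (hn₀ : 1 ≤ n₀) : ∃ a : ℕ, 1 ≤ a ∧ c ≤ gronwallG (a * n₀) := by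
  have hlogx : Tendsto (fun x : ℕ ↦ Real.log x) atTop atTop :=
    Real.tendsto_log_atTop.comp tendsto_natCast_atTop_atTop
  have hj : Tendsto (fun x : ℕ ↦ ⌊Real.log x⌋₊) atTop atTop := tendsto_nat_floor_atTop.comp hlogx
  have hev : ∀ᶠ x : ℕ in atTop, c < (1 - 2 / (2 : ℝ) ^ ⌊Real.log x⌋₊) *
      (∏ p ∈ Nat.primesLE x, (1 - (p : ℝ)⁻¹))⁻¹ /
        (Real.log (⌊Real.log x⌋₊ : ℕ) + Real.log x + Real.log (Real.log 4)) :=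
    (tendsto_order.1 tendsto_F₂).1 c hc
  obtain ⟨x, hcx, hx, hjn⟩ := (hev.and ((eventually_ge_atTop (max 3 n₀)).and
    (hj.eventually (eventually_ge_atTop n₀)))).exists
  have hx3 : 3 ≤ x := le_trans (le_max_left _ _) hx
  have hxn : n₀ ≤ x := le_trans (le_max_right _ _) hx
  have hj1 : 1 ≤ ⌊Real.log x⌋₊ := le_trans hn₀ hjn
  have hF := sigma_div_loglog_primorial_pow_ge hx3 hj1
  -- `N = (x#)^j` is a multiple of `n₀`
  obtain ⟨a, ha⟩ := dvd_primorial_pow hn₀ hxn hjn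
  have hN0 : 0 < primorial x ^ ⌊Real.log x⌋₊ := pow_pos (primorial_pos x) _
  have ha1 : 1 ≤ a := by
    rcases Nat.eq_zero_or_pos a with h0 | h0
    · rw [h0, mul_zero] at ha; omega
    · exact h0
  refine ⟨a, ha1, ?_⟩
  rw [mul_comm, ← ha, gronwallG]
  push_cast at hF ⊢
  exact hcx.le.trans hF

/-- **CNS 2012, (1.11) / CNS 2011 via Lemma 1 (PROVED)**: "`N` is GA2 `⟹ G(N) ≥ e^γ`".
[cite: CaveneyNicolasSondow2012, (1.11)] -/
theorem IsGA2.exp_eulerMascheroni_le_gronwallG {N : ℕ} (h : IsGA2 N) :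
    rexp eulerMascheroniConstant ≤ gronwallG N := by
  refine le_of_forall_lt fun c hc => ?_
  obtain ⟨a, ha1, hca⟩ := exists_multiple_le_gronwallG
    (show (c + rexp eulerMascheroniConstant) / 2 < rexp eulerMascheroniConstant by linarith) h.1.le
  have hle := h.2 a ha1
  linarith

/-- **CNS 2012, Thm. 5 (ii), kernel-grade form (PROVED)** over the named fact `robin_iff`: if RH
holds, no GA2 number exceeds `5040` (a GA2 number `N > 5040` would have `G(N) ≥ e^γ`, against
Robin's inequality). [cite: CaveneyNicolasSondow2012, Thm. 5 (ii)] -/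
theorem CNS2012_thm5_ii_of (hR : robin_iff) (hRH : RiemannHypothesis) {N : ℕ} (hN : IsGA2 N) :
    N ≤ 5040 := by
  by_contra hlt
  push Not at hlt
  have hrob : robinInequality N := (robin_iff_iff.1 hR).1 hRH N hlt
  have hG := hN.exp_eulerMascheroni_le_gronwallG
  exact absurd ((robinInequality_iff_gronwallG_lt (by omega)).1 hrob) (not_lt.2 hG)

/-- **CNS 2012, Thm. 5 (ii) (PROVED, unconditional form)**: under RH no GA2 number exceeds `5040`
(`robin_iff_holds`; closure `computational`). [cite: CaveneyNicolasSondow2012, Thm. 5 (ii)] -/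
theorem CNS2012_thm5_ii (hRH : RiemannHypothesis) {N : ℕ} (hN : IsGA2 N) : N ≤ 5040 :=
  CNS2012_thm5_ii_of robin_iff_holds hRH hN

/-! ### The Caveney–Nicolas–Sondow criteria (NAMED FACTS) -/

/-- NAMED FACT **Caveney–Nicolas–Sondow 2011, Thm. 5** ("The Riemann Hypothesis is true if and
only if `4` is the only extraordinary number"; also CNS 2012 Thm. 4 (i); Broughan vol. 1, Ch. 9;
MacKay, LMS Newsletter 480). Spelled out: RH iff for every `N`, `N` is extraordinary exactly when
`N = 4` (CNS prove unconditionally that `4` is extraordinary, §1, from Robin's Thm. 2). Proof in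
print: Robin's criterion, Gronwall's theorem, Lemma 1, and the table of the 27 numbers `r ≤ 5040`
with `G(r) ≥ e^γ` (Lemmas 2–3). Users take `(h : CNS2011_thm5)`.
[cite: CaveneyNicolasSondow2011, Thm. 5; CaveneyNicolasSondow2012, Thm. 4 (i); Broughan2017Arithmetic, Ch. 9 (pp. 218–235)] -/
def CNS2011_thm5 : Prop :=
  RiemannHypothesis ↔ ∀ N : ℕ, IsExtraordinary N ↔ N = 4

/-- NAMED FACT **Caveney–Nicolas–Sondow 2011, Cor. 1** (= CNS 2012 Thm. 4 (ii)): "If there is any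
counterexample to Robin's inequality, then the maximum `M := max{G(n) : n > 5040}` exists and the
least number `N > 5040` with `G(N) = M` is extraordinary." Users take `(h : CNS2011_cor1)`.
[cite: CaveneyNicolasSondow2011, Cor. 1; CaveneyNicolasSondow2012, Thm. 4 (ii)] -/
def CNS2011_cor1 : Prop :=
  (∃ n : ℕ, 5040 < n ∧ ¬ robinInequality n) →
    ∃ N : ℕ, 5040 < N ∧ (∀ n : ℕ, 5040 < n → gronwallG n ≤ gronwallG N) ∧
      (∀ n : ℕ, 5040 < n → n < N → gronwallG n < gronwallG N) ∧ IsExtraordinary N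

/-- The nineteen GA2 numbers `≤ 5040` of CNS 2012, Thm. 5 (i).
[cite: CaveneyNicolasSondow2012, Thm. 5 (i)] -/
def CNS2012.setR2 : Finset ℕ :=
  {3, 4, 5, 6, 8, 10, 12, 18, 24, 36, 48, 60, 72, 120, 180, 240, 360, 2520, 5040}

/-- NAMED FACT, RH-FREE **CNS 2012, Thm. 5 (i)**: "The set of GA2 numbers `≤ 5040` is
`{3, 4, 5, 6, 8, 10, 12, 18, 24, 36, 48, 60, 72, 120, 180, 240, 360, 2520, 5040}`." Users take
`(h : CNS2012_thm5_i)`. [cite: CaveneyNicolasSondow2012, Thm. 5 (i)] -/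
def CNS2012_thm5_i : Prop :=
  ∀ N : ℕ, N ≤ 5040 → (IsGA2 N ↔ N ∈ CNS2012.setR2)

/-- NAMED FACT **CNS 2012, Thm. 5 (iii)**: "If the Riemann Hypothesis is false, then infinitely
many GA2 numbers exist; moreover, the inequality `μ := max{G(n) : n > 5040} > e^γ` holds, and any
integer `A > 5040` for which `G(A) = μ` is both GA2 and CA" (colossally abundant, the tree's
`Nat.ColossallyAbundant`). The maximum is spelled out by a maximiser `A₀ > 5040`. Users take
`(h : CNS2012_thm5_iii)`. [cite: CaveneyNicolasSondow2012, Thm. 5 (iii)] -/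
def CNS2012_thm5_iii : Prop :=
  ¬ RiemannHypothesis →
    {N : ℕ | IsGA2 N}.Infinite ∧
      ∃ A₀ : ℕ, 5040 < A₀ ∧ (∀ n : ℕ, 5040 < n → gronwallG n ≤ gronwallG A₀) ∧
        rexp eulerMascheroniConstant < gronwallG A₀ ∧
        ∀ A : ℕ, 5040 < A → gronwallG A = gronwallG A₀ → IsGA2 A ∧ Nat.ColossallyAbundant A

/-- NAMED FACT, RH-FREE **CNS 2012, Cor. 1**: "There is no GA2 or extraordinary number between
`5041` and `10^8576`." Users take `(h : CNS2012_cor1)`. [cite: CaveneyNicolasSondow2012, Cor. 1] -/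
def CNS2012_cor1 : Prop :=
  ∀ N : ℕ, 5041 ≤ N → N ≤ 10 ^ 8576 → ¬ IsGA2 N ∧ ¬ IsExtraordinary N

/-- **`RH ⟺` every GA2 number is `≤ 5040`** (CNS 2012, Thm. 5 (ii)+(iii); Broughan vol. 1, Ch. 9),
kernel-grade form PROVED from the named facts `robin_iff` (for (ii)) and `CNS2012_thm5_iii`.
[cite: CaveneyNicolasSondow2012, Thm. 5 (ii)-(iii)] -/
theorem riemannHypothesis_iff_forall_isGA2_le_of (hR : robin_iff) (h3 : CNS2012_thm5_iii) :
    RiemannHypothesis ↔ ∀ N : ℕ, IsGA2 N → N ≤ 5040 := by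
  refine ⟨fun hRH N hN => CNS2012_thm5_ii_of hR hRH hN, fun h => ?_⟩
  by_contra hRH
  obtain ⟨hinf, -⟩ := h3 hRH
  exact hinf (Set.Finite.subset (Set.finite_Iic 5040) fun N hN => h N hN)

/-- **`RH ⟺` the set of GA2 numbers is finite** (CNS 2012, Thm. 5 (ii)+(iii)), kernel-grade form
PROVED from `robin_iff` and `CNS2012_thm5_iii`. [cite: CaveneyNicolasSondow2012, Thm. 5 (ii)-(iii)] -/
theorem riemannHypothesis_iff_setOf_isGA2_finite_of (hR : robin_iff) (h3 : CNS2012_thm5_iii) :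
    RiemannHypothesis ↔ {N : ℕ | IsGA2 N}.Finite := by
  refine ⟨fun hRH => Set.Finite.subset (Set.finite_Iic 5040)
    fun N hN => CNS2012_thm5_ii_of hR hRH hN, fun h => ?_⟩
  by_contra hRH
  exact (h3 hRH).1 h

/-- Unconditional forms of the two GA2 criteria (with `robin_iff_holds`; closure `computational`),
still over the named fact `CNS2012_thm5_iii`. [cite: CaveneyNicolasSondow2012, Thm. 5 (ii)-(iii)] -/
theorem riemannHypothesis_iff_forall_isGA2_le (h3 : CNS2012_thm5_iii) :
    (RiemannHypothesis ↔ ∀ N : ℕ, IsGA2 N → N ≤ 5040) ∧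
      (RiemannHypothesis ↔ {N : ℕ | IsGA2 N}.Finite) :=
  ⟨riemannHypothesis_iff_forall_isGA2_le_of robin_iff_holds h3,
    riemannHypothesis_iff_setOf_isGA2_finite_of robin_iff_holds h3⟩

/-! ### Extremely abundant numbers (Nazardonyavi–Yakubovich 2014) -/

/-- **Extremely abundant (XA) numbers** (Nazardonyavi–Yakubovich 2014, Def. 2.1): "a positive
integer `n` is extremely abundant if either `n = 10080`, or `n > 10080` and
`σ(m)/(m log log m) < σ(n)/(n log log n)` for all `10080 ≤ m < n`" (`10080` = the least
superabundant number `> 5040`). [cite: NazardonyaviYakubovich2014, Def. 2.1] -/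
def IsExtremelyAbundant (n : ℕ) : Prop :=
  n = 10080 ∨ (10080 < n ∧ ∀ m : ℕ, 10080 ≤ m → m < n → gronwallG m < gronwallG n)

/-- `10080` is extremely abundant (by definition). [cite: NazardonyaviYakubovich2014, Def. 2.1] -/
theorem isExtremelyAbundant_10080 : IsExtremelyAbundant 10080 := Or.inl rfl

/-- An extremely abundant number is `≥ 10080`. [cite: NazardonyaviYakubovich2014, Def. 2.1] -/
theorem IsExtremelyAbundant.le {n : ℕ} (h : IsExtremelyAbundant n) : 10080 ≤ n := by
  rcases h with rfl | ⟨h, -⟩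
  · exact le_rfl
  · exact h.le

/-- The record property of an extremely abundant `n`: `G(m) < G(n)` for `10080 ≤ m < n`.
[cite: NazardonyaviYakubovich2014, Def. 2.1] -/
theorem IsExtremelyAbundant.gronwallG_lt {n m : ℕ} (h : IsExtremelyAbundant n) (hm : 10080 ≤ m)
    (hmn : m < n) : gronwallG m < gronwallG n := by
  rcases h with rfl | ⟨-, h⟩
  · omega
  · exact h m hm hmn

/-- **Nazardonyavi–Yakubovich 2014, Thm. 2.3 (PROVED)**: "If there is any counterexample to Robin's
inequality, then the least one is an extremely abundant number." (There `n > 5040`; the printed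
proof's computer check that there is no counterexample in `(5040, 10080]` is the tree's kernel
theorem `robinInequality_le_55440`.) [cite: NazardonyaviYakubovich2014, Thm. 2.3] -/
theorem isExtremelyAbundant_of_least_not_robinInequality {n : ℕ} (hn : 5040 < n)
    (hfail : ¬ robinInequality n) (hleast : ∀ m : ℕ, 5040 < m → m < n → robinInequality m) :
    IsExtremelyAbundant n := by
  have hn' : 55440 < n := by
    by_contra hle
    exact hfail (robinInequality_le_55440 n hn (not_lt.1 hle))
  refine Or.inr ⟨by omega, fun m hm hmn => ?_⟩
  have hGm := (robinInequality_iff_gronwallG_lt (by omega)).1 (hleast m (by omega) hmn)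
  exact lt_of_lt_of_le hGm (exp_eulerMascheroni_le_gronwallG_of_not_robinInequality (by omega) hfail)

/-- If some `k₀ ≥ 10080` maximises `G` on `[10080, ∞)`, every extremely abundant number is `≤ k₀`
(the step common to both halves of Nazardonyavi–Yakubovich's Thm. 2.4).
[cite: NazardonyaviYakubovich2014, Thm. 2.4 (proof)] -/
theorem IsExtremelyAbundant.le_of_isMax {k₀ n : ℕ} (hk₀ : 10080 ≤ k₀)
    (hmax : ∀ k : ℕ, 10080 ≤ k → gronwallG k ≤ gronwallG k₀) (hn : IsExtremelyAbundant n) :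
    n ≤ k₀ := by
  by_contra hlt
  push Not at hlt
  exact absurd (hn.gronwallG_lt hk₀ hlt) (not_lt.2 (hmax n hn.le))

/-- **Nazardonyavi–Yakubovich 2014, Thm. 2.4, the `⟸` half ("sufficiency"), kernel-grade form**
over the named fact `robin_iff`: if there are infinitely many extremely abundant numbers then RH
holds. (If RH fails, Robin's inequality fails at some `m ≥ 10080`, so `G(m) ≥ e^γ`; by Gronwall's
theorem `G` then attains its maximum over `[10080, ∞)` at some `k₀`, and no `n > k₀` is XA.)
[cite: NazardonyaviYakubovich2014, Thm. 2.4] -/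
theorem riemannHypothesis_of_setOf_isExtremelyAbundant_infinite_of (hR : robin_iff)
    (hinf : {n : ℕ | IsExtremelyAbundant n}.Infinite) : RiemannHypothesis := by
  by_contra hRH
  -- a counterexample to Robin's inequality, necessarily `> 55440 ≥ 10080`
  obtain ⟨m, hm, hmfail⟩ : ∃ m : ℕ, 5040 < m ∧ ¬ robinInequality m := by
    by_contra hall
    push Not at hall
    exact hRH ((robin_iff_iff.1 hR).2 hall)
  have hm' : 55440 < m := by
    by_contra hle
    exact hmfail (robinInequality_le_55440 m hm (not_lt.1 hle))
  have hGm : rexp eulerMascheroniConstant ≤ gronwallG m :=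
    exp_eulerMascheroni_le_gronwallG_of_not_robinInequality (by omega) hmfail
  -- a maximiser `k₀` of `G` on `[10080, ∞)`
  obtain ⟨k₀, hk₀, hmax⟩ : ∃ k₀ : ℕ, 10080 ≤ k₀ ∧ ∀ k : ℕ, 10080 ≤ k → gronwallG k ≤ gronwallG k₀ := by
    by_cases hcase : ∃ m₁ : ℕ, 10080 ≤ m₁ ∧ rexp eulerMascheroniConstant < gronwallG m₁
    · obtain ⟨m₁, hm₁, hGm₁⟩ := hcase
      -- the set `S = {k ≥ 10080 : G(m₁) ≤ G(k)}` is finite (Gronwall) and contains `m₁`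
      have hev := eventually_sigma_div_loglog_le
        (show rexp eulerMascheroniConstant < (rexp eulerMascheroniConstant + gronwallG m₁) / 2 by
          linarith)
      obtain ⟨K, hK⟩ := eventually_atTop.1 hev
      classical
      let S : Finset ℕ := (Finset.range K).filter fun k => 10080 ≤ k ∧ gronwallG m₁ ≤ gronwallG k
      have hmemS : ∀ k : ℕ, 10080 ≤ k → gronwallG m₁ ≤ gronwallG k → k ∈ S := by
        intro k hk hGk
        refine Finset.mem_filter.2 ⟨Finset.mem_range.2 ?_, hk, hGk⟩
        by_contra hKk
        have := hK k (not_lt.1 hKk)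
        rw [← gronwallG_def] at this
        linarith
      have hSne : S.Nonempty := ⟨m₁, hmemS m₁ hm₁ le_rfl⟩
      obtain ⟨k₀, hk₀S, hk₀max⟩ := Finset.exists_max_image S gronwallG hSne
      have hk₀' := (Finset.mem_filter.1 hk₀S).2
      refine ⟨k₀, hk₀'.1, fun k hk => ?_⟩
      by_cases hGk : gronwallG m₁ ≤ gronwallG k
      · exact hk₀max k (hmemS k hk hGk)
      · exact le_trans (le_of_lt (not_le.1 hGk)) hk₀'.2
    · push Not at hcase
      refine ⟨m, by omega, fun k hk => le_trans (hcase k hk) hGm⟩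
  -- every XA number is `≤ k₀`: contradiction with infinitude
  exact hinf (Set.Finite.subset (Set.finite_Iic k₀)
    fun n hn => IsExtremelyAbundant.le_of_isMax hk₀ hmax hn)

/-- **Nazardonyavi–Yakubovich 2014, Thm. 2.4, the `⟹` half ("necessity"), kernel-grade form** over
`robin_iff`: under RH there are infinitely many extremely abundant numbers. (If XA were finite, a
maximiser `k₀` of `G` over XA would bound `G` on all of `[10080, ∞)` — by strong induction, a
non-XA `k > 10080` has `G(k) ≤ G(m)` for some `10080 ≤ m < k` — while `G(k₀) < e^γ` by Robin,
contradicting Gronwall's `lim sup G = e^γ`.) [cite: NazardonyaviYakubovich2014, Thm. 2.4] -/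
theorem setOf_isExtremelyAbundant_infinite_of (hR : robin_iff) (hRH : RiemannHypothesis) :
    {n : ℕ | IsExtremelyAbundant n}.Infinite := by
  intro hfin
  classical
  -- a maximiser of `G` over the finite nonempty set XA
  obtain ⟨k₀, hk₀XA, hk₀max⟩ :=
    Finset.exists_max_image hfin.toFinset gronwallG ⟨10080, hfin.mem_toFinset.2 isExtremelyAbundant_10080⟩
  have hk₀ : IsExtremelyAbundant k₀ := hfin.mem_toFinset.1 hk₀XA
  -- `G(k) ≤ G(k₀)` for every `k ≥ 10080`, by strong induction
  have hbound : ∀ k : ℕ, 10080 ≤ k → gronwallG k ≤ gronwallG k₀ := by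
    intro k
    induction k using Nat.strong_induction_on with
    | _ k ih =>
      intro hk
      by_cases hXA : IsExtremelyAbundant k
      · exact hk₀max k (hfin.mem_toFinset.2 hXA)
      · have hk' : 10080 < k := by
          rcases hk.eq_or_lt with h | h
          · exact absurd (h ▸ isExtremelyAbundant_10080) hXA
          · exact h
        have hnot : ¬ ∀ m : ℕ, 10080 ≤ m → m < k → gronwallG m < gronwallG k :=
          fun hall => hXA (Or.inr ⟨hk', hall⟩)
        push Not at hnot
        obtain ⟨m, hm, hmk, hGmk⟩ := hnot
        exact le_trans hGmk (ih m hmk hm)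
  -- but `G(k₀) < e^γ` by Robin's inequality under RH (`k₀ ≥ 10080 > 5040`)
  have hrob : robinInequality k₀ := (robin_iff_iff.1 hR).1 hRH k₀ (by linarith [hk₀.le])
  have hGk₀ := (robinInequality_iff_gronwallG_lt (by linarith [hk₀.le])).1 hrob
  -- contradiction with Gronwall's theorem
  have hfreq := frequently_le_sigma_div_loglog
    (show (gronwallG k₀ + rexp eulerMascheroniConstant) / 2 < rexp eulerMascheroniConstant by
      linarith)
  have hev : ∀ᶠ n : ℕ in atTop, (σ 1 n : ℝ) / (n * Real.log (Real.log n)) <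
      (gronwallG k₀ + rexp eulerMascheroniConstant) / 2 := by
    filter_upwards [eventually_ge_atTop 10080] with n hn
    rw [← gronwallG_def]
    linarith [hbound n hn]
  obtain ⟨n, hn1, hn2⟩ := (hfreq.and_eventually hev).exists
  linarith

/-- **Nazardonyavi–Yakubovich 2014, Thm. 2.4, kernel-grade form (PROVED)** over the named fact
`robin_iff`: "The Riemann hypothesis is true if and only if `#XA = ∞`."
[cite: NazardonyaviYakubovich2014, Thm. 2.4; Broughan2017Arithmetic, Ch. 9 (pp. 218–235)] -/
theorem riemannHypothesis_iff_setOf_isExtremelyAbundant_infinite_of (hR : robin_iff) :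
    RiemannHypothesis ↔ {n : ℕ | IsExtremelyAbundant n}.Infinite :=
  ⟨setOf_isExtremelyAbundant_infinite_of hR,
    riemannHypothesis_of_setOf_isExtremelyAbundant_infinite_of hR⟩

/-- **Nazardonyavi–Yakubovich 2014, Thm. 2.4 (PROVED)**: `RH ⟺` there are infinitely many
extremely abundant numbers. Unconditional (Robin's criterion enters as the tree's theorem
`robin_iff_holds`, closure `computational`).
[cite: NazardonyaviYakubovich2014, Thm. 2.4; Broughan2017Arithmetic, Ch. 9 (pp. 218–235)] -/
theorem riemannHypothesis_iff_setOf_isExtremelyAbundant_infinite :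
    RiemannHypothesis ↔ {n : ℕ | IsExtremelyAbundant n}.Infinite :=
  riemannHypothesis_iff_setOf_isExtremelyAbundant_infinite_of robin_iff_holds

end Literature.NumberTheory.LFunctions

end
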